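import Summits.KontsevichZagierPeriods.KontsevichZagierPeriods.Theorems.RootDecompRelativeModAbsoluteCircleSplitP11
import Summits.KontsevichZagierPeriods.KontsevichZagierPeriods.Theorems.RootDecompRelativeModAbsoluteEvenCircleP10
import Summits.KontsevichZagierPeriods.KontsevichZagierPeriods.Theorems.RootDecompRelativeModAbsoluteCylLogSplitP48
import Summits.KontsevichZagierPeriods.KontsevichZagierPeriods.Theorems.RootDecompRelativeModAbsoluteCircleLogP6

/-! # Item 30572 `RegKernelPairDegOne` from the accepted tree theorem `BoundaryRigidity` ALONE

decomp-kz census-1 g10 (landing seat) — the in-tree composition of the lens-3 g13/g14 chain (critic CLEARED g6-21 l.1371, g7-2 l.1388):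
`LogStructure` is DISCHARGED by name (`G13.logStructure`, …CircleLogP6), `CylKernelZeroLog` comes from the tree (`cylKernelZeroLog_of_trees`, P45),
the kernel split + odd→log give `G13.cylKernelZeroCirclePos_of_log_and_evenCircle` (…CircleSplitP11 §27) and the residual is PROVED
(`G13.evenCircleCellClose_holds`, …EvenCircleP10 §K12).  The only remaining input is
`Summit.KontsevichZagierPeriods.LiouvilleUnfolding.LogPrimitiveNL.Negative.BoundaryRigidity` — an ACCEPTED tree theorem
(`boundaryRigidity_of_stubs`, `Theorems/LiouvilleUnfoldingLogPrimitiveNL.lean` l.44, crux 2836 CLOSED) whose module is not yet built on the farm;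
the unconditional closer `regKernelPairDegOne_holds` (file `…RegKernelPairDegOne.lean`) is this theorem applied to it. --supports stmt-KontsevichZagierPeriods-30572. -/

namespace Summit.KontsevichZagierPeriods.RootDecompRelativeModAbsolute.Rung30571.RegularisedLogLayer.CylLog.Leaf

/-- **`CylKernelZeroCirclePos` from `BoundaryRigidity` alone**: the circle leaf of the degree-one regularised log layer closes inside the four-move calculus,
given the tree's boundary-rigidity theorem (module farm-unbuilt, hence carried by statement). Composition of `cylKernelZeroLog_of_trees` (P45, with
`LogStructure := G13.logStructure`), `G13.cylKernelZeroCirclePos_of_log_and_evenCircle` (§27) and `G13.evenCircleCellClose_holds` (§K12). -/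
theorem cylKernelZeroCirclePos_of_boundaryRigidity
    (hBR : Summit.KontsevichZagierPeriods.LiouvilleUnfolding.LogPrimitiveNL.Negative.BoundaryRigidity) :
    CylKernelZeroCirclePos :=
  G13.cylKernelZeroCirclePos_of_log_and_evenCircle (cylKernelZeroLog_of_trees G13.logStructure hBR) G13.evenCircleCellClose_holds

/-- **Item 30572 from `BoundaryRigidity` alone**: `BoundaryRigidity → Theses.RootDecompRelativeModAbsolute.RegKernelPairDegOne`
(via `regKernelPairDegOne_iff_circlePos_of_trees`, P48). -/
theorem regKernelPairDegOne_of_boundaryRigidity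
    (hBR : Summit.KontsevichZagierPeriods.LiouvilleUnfolding.LogPrimitiveNL.Negative.BoundaryRigidity) :
    Summit.KontsevichZagierPeriods.KontsevichZagierPeriods.Theses.RootDecompRelativeModAbsolute.RegKernelPairDegOne :=
  (regKernelPairDegOne_iff_circlePos_of_trees G13.logStructure hBR).mpr (cylKernelZeroCirclePos_of_boundaryRigidity hBR)

end Summit.KontsevichZagierPeriods.RootDecompRelativeModAbsolute.Rung30571.RegularisedLogLayer.CylLog.Leaf
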